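import Literature.MathematicalPhysics.QuantumLattice.HubbardModel
import Literature.MathematicalPhysics.QuantumLattice.HubbardRectangularTorus
import Literature.MathematicalPhysics.QuantumLattice.HubbardTorus2DEnergyDensity
import Literature.MathematicalPhysics.QuantumLattice.HeisenbergModel
import Literature.MathematicalPhysics.QuantumLattice.HubbardDoubleOccupancyBounds
import Literature.MathematicalPhysics.QuantumLattice.HubbardFreeKineticLowerBound
import Literature.MathematicalPhysics.QuantumLattice.HubbardTorus2DEnergyDensityConvex
import Literature.MathematicalPhysics.QuantumLattice.HubbardEnergyDensityChemicalPotential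
import Literature.MathematicalPhysics.QuantumLattice.HubbardModelParticleHoleProofs
import Literature.MathematicalPhysics.QuantumLattice.HubbardHubbardModelEtaPairingProofs
import Literature.MathematicalPhysics.QuantumLattice.HubbardModelProofs
import HarnessLib
import Summits.HubbardSuperconductivity.ManyBodyBootstrap.Bounds.E2.Defs
import HarnessLib.Audit

/-!
# Many-body bootstrap — Bounds, adversarial-comparison family (`Adv1`): certified endpoints used against published numerics

Cell pub-mbboot (bundle `papers/HubbardSuperconductivity/manybody-bootstrap/`, HOME `run/shared/lean/pub/pub-mbboot/`), unit
pub-mbboot-adv-1 (ADV-1 ENERGIES). HONEST FRAMING: adversarial comparison against published numerics; certified intervals only —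
certified numerical bounds on a lattice model; not superconductivity, not a phase diagram. All at `t = 1`.

This directory (`…/ManyBodyBootstrap/Bounds/Adv1/`) is the in-tree form of the cell's staged module `HOME/lean/HubbardCertifiedBoundsAdv1.lean`
(generated by adv-1's `code/make_lean_adv1.py`, 2026-08-20T12:09Z, 419 rows + 50 proved transport theorems; every row names its certificate
under `HOME/pub-mbboot-adv-1/certs/` with sha256 — README.md + SHA256SUMS there — each certificate evaluated by TWO independent
implementations in exact or outward-rounded arithmetic, the docstring says which and the producing `kit compute` job), split into parts
of ≤ 400 lines by the cell's literature seat (tool `file_parts_g19.py`; unit→part table in HOME/PLACEMENT.md):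

* `Adv1/Defs` (this file): the helper shapes `E0Lower` / `E0Upper` (RE-EXPORTED from the E2 family `Bounds/E2/Defs.lean` — the same constants), `E0LowerAllU` (torus `fermionRectTorusGraph a b`, `groundEnergyAt`),
  `DensityLower` / `DensityUpper` (re-exported from E2) / `DensityLowerAllU` / `DensityUpperAllU` (`energyDensity2D`), and the torus-family lower shapes
  `HubTorusFamilyLower` / `HeisTorusFamilyLower` (finite-torus corollaries of thermodynamic-limit window certificates through their
  support box) — the same shapes as the E2 family, so a statement about the same torus / sector / coupling is syntactically the same `Prop`;
* `Adv1/Rows1–5`: the certified endpoints of `HOME/RESULTS-ADV.md`, kinds `ed-sector-upper` (`edUpper_*`, variational principle with an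
  explicit integer vector), `lm-torus-lower(-doped)` (`lmLower_*`, Langer–Mattis), `hf-torus-upper` (`hfUpper_*`), `lm44-lower`,
  `ff-torus-upper` (`ffUpper_*`, free-fermion Slater states), `kinetic-torus-lower-allU` (`kinLower_*`), `ff-TL-upper` (`ffTLUpper_*`),
  `kinetic-TL-lower-allU` (`kinTLLower_*`), support-box torus families (`sbxTorus_*`, E1 certsdp/1 reduce-mode certificates read on
  finite tori through the independently recomputed support box), plane-wave `4×4` uppers (`ff44pw_*`), spin-polarised TL uppers
  (`fmTL_*`), and the two-sided half-filled ring enclosures (`ringLower_*` / `ringUpper_*`, outward dyadic 2⁻⁷², two implementations);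
* `Adv1/TransportU1`, `Adv1/TransportU2` (§F, PROVED): `groundEnergyAt_mono_U` (`E_N(U)` monotone in `U`), `energyDensity2D_mono_U`,
  `chord_le_of_concaveOn`, and one theorem per endpoint of RESULTS-ADV transported along `U` (parent endpoints as hypotheses in the helper
  shapes; tree `DoubleOccupancy.concaveOn_groundEnergyAt` / `concaveOn_energyDensity2D`);
* `Adv1/TransportDensity` (§G, PROVED): `convex_three_point` and its secant / chord readings, `energyDensity2D_density_zero`,
  `energyDensity2D_particleHole` (`e(t,U,2−n) = e(t,U,n) + U(1−n)`), `energyDensity2D_le_add_half_U`, and one theorem per endpoint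
  transported in the density.

The soundness step of each row kind is a PROVED tree theorem named in its docstring (`LangerMattis.hubbardTorus_groundEnergyAt_ge`,
`HartreeFock.hubbardTorus_groundEnergyAt_le_sdw_momentum`, `FreeKinetic.hubbardTorus_groundEnergyAt_ge`, `convexOn_energyDensity2D`,
`groundEnergyAt_div_ge_of_window_certificate_d4`, …). CONVENTIONS (as in `HubbardLadder/Bounds`, `ManyBodyBootstrap/Bounds`): every
certificate-backed statement is a CLAIM NODE `@[conjecture] def <row> : Prop` — an open obligation node closable in-kernel from the
certificate's exact data, NOT a vendored fact, NOT a citation; its docstring ends with `[computation: <kind>, exact ℚ]`; no statement here is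
cited anywhere as a fact; the §F/§G theorems take the rows they use as hypotheses. Declarations are byte-identical to the staged module except
for the namespace (`Summit.HubbardSuperconductivity.Bounds.Adv1` → `Summit.HubbardSuperconductivity.ManyBodyBootstrap.Bounds.Adv1`; the four basic
shapes re-exported from `…Bounds.E2` instead of re-declared with identical bodies; references
to the typer's family likewise `…Bounds` → `…ManyBodyBootstrap.Bounds`), the attribute and the tag. Landed tree files are append-only: later
adv-1 rows arrive as further parts.
-/

noncomputable section

namespace Summit.HubbardSuperconductivity.ManyBodyBootstrap.Bounds.Adv1

open Literature.MathematicalPhysics.QuantumLattice Literature.MathematicalPhysics.QuantumLattice.ThermodynamicLimit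
open Literature.Probability.LatticeModels
open Matrix

-- The four basic helper shapes are SHARED with the E2 family (same constants, not copies): `E0Lower`, `E0Upper`,
-- `DensityLower`, `DensityUpper` are re-exported from `…ManyBodyBootstrap.Bounds.E2` (file `Bounds/E2/Defs.lean`), so an
-- adv-1 statement and an E2 statement about the same torus / sector / coupling are literally the same `Prop`.
export Summit.HubbardSuperconductivity.ManyBodyBootstrap.Bounds.E2 (E0Lower E0Upper DensityLower DensityUpper)

/-- `q ≤ E₀(N)` on the `a×b` torus for EVERY repulsion `U ≥ 0` (free-kinetic bounds). -/
def E0LowerAllU (a b : ℕ) (t : ℚ) (N : ℕ) (q : ℚ) : Prop :=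
  ∀ U : ℝ, 0 ≤ U → (q : ℝ) ≤ groundEnergyAt (fermionRectTorusGraph a b) (t : ℝ) U N

/-- `q ≤ e(t,U,n)` for EVERY `U ≥ 0` (free-kinetic bounds). -/
def DensityLowerAllU (t n q : ℚ) : Prop :=
  ∀ U : ℝ, 0 ≤ U → (q : ℝ) ≤ energyDensity2D (t : ℝ) U (n : ℝ)

/-- `e(t,U,n) ≤ q` for EVERY `U ≥ 0` (spin-polarised free-fermion bounds, gen 10). -/
def DensityUpperAllU (t n q : ℚ) : Prop :=
  ∀ U : ℝ, 0 ≤ U → energyDensity2D (t : ℝ) U (n : ℝ) ≤ (q : ℝ)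

/-- Finite-torus corollary family of a thermodynamic-limit window certificate with support-box threshold `Lmin`:
for every even `L ≥ Lmin` and every even particle number `N = n·L²`, `L²·e ≤ E₀((ℤ/Lℤ)², t = 1, U, N)`
(conclusion shape of `groundEnergyAt_div_ge_of_window_certificate_d4` with `nh = N/2`, the density multiplier term vanishing at `nh/L² = n/2`). -/
def HubTorusFamilyLower (Lmin : ℕ) (U n e : ℚ) : Prop :=
  ∀ L N : ℕ, Even L → Lmin ≤ L → Even N → (N : ℚ) = n * (L : ℚ) ^ 2 →
    (L : ℝ) ^ 2 * (e : ℝ) ≤ groundEnergyAt (fermionTorusGraph 2 L) (1 : ℝ) (U : ℝ) N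

/-- Finite-torus corollary family of a thermodynamic-limit Heisenberg window certificate with threshold `Lmin`:
for every even `L ≥ Lmin`, `L²·e ≤ E₀(heisenbergHamiltonian 1 (torusGraph 2 L) 1)` (spin ½, `J = 1`, whole space). -/
def HeisTorusFamilyLower (Lmin : ℕ) (e : ℚ) : Prop :=
  ∀ (L : ℕ) [NeZero L], Even L → Lmin ≤ L →
    (L : ℝ) ^ 2 * (e : ℝ) ≤ (heisenbergHamiltonian 1 (torusGraph 2 L) 1).groundEnergy

/-- Bridge used implicitly throughout: the square torus as a rectangular torus. -/
example (L N : ℕ) (U : ℝ) : groundEnergyAt (fermionTorusGraph 2 L) 1 U N = groundEnergyAt (fermionRectTorusGraph L L) 1 U N :=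
  groundEnergyAt_fermionTorusGraph_two L 1 U N

end Summit.HubbardSuperconductivity.ManyBodyBootstrap.Bounds.Adv1

end
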